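import Literature.Analysis.FluidPDE.FluidComputer.ReachCertificate
import HarnessLib

/-!
# Fluid computer blueprint — refining and retargeting stage certificates

HONEST FRAMING: low prior, high value-of-information experiment on Tao's machine paradigm; NOT a
claim that NS blows up. Everything in this file is elementary bookkeeping about the reach layer's
interface `ReachCertificate` (`ReachCertificate.lean`); nothing is asserted about any fluid
equation, and nothing about any particular gate.

## Why

Stage certificates are composed by `ReachCertificate.comp` (`CertificateComposition.lean`), whose
hand-off hypothesis is `Tube₁ p τ₁ ⊆ Amid`: everything the next stage needs to know about its
starting state must be recorded IN THE TUBE of the previous stage. A stage certificate proved once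
with an economical tube (e.g. the pre-threshold boxes of the threshold gate) therefore has to be
REFINED by further certified conditions (e.g. "the trigger is non-negative", which the ignition
theorem needs at its start) and RETARGETED to the next stage's input region, without re-proving it.
This file supplies the combinators:
* `restrict` — intersect the tube with a family of conditions `K p σ` that has a closed graph,
  holds at the start, and is certified along every admissible curve (same binders as `cert`);
  `restrictConst` — the time-independent case of a closed set;
* `monoIn` — shrink the input region; `monoOut` — enlarge the output region;
* `withHandoff` — retarget the output region to any set containing the end-of-stage tubes
  `Tube p τc` (REACH is then witnessed at the final time); `toHandoff` — to their union `handoff`.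
All proofs are one-liners; the point is that the interface is closed under these operations, so
the stage-by-stage certification of a gate cycle is bookkeeping once each stage is a theorem.
[cite: Tao2016AveragedNS, §5.5 (the three phases of Thm 5.3); §1.3 pp. 10–11]
-/

noncomputable section

open Set Filter Topology
open scoped NNReal

namespace Literature.Analysis.FluidPDE.FluidComputer

variable {O : Type*} [NormedAddCommGroup O] [NormedSpace ℝ O]

namespace ReachCertificate

variable {F : O → O} {U : Set O} {ε τc : ℝ} {Ain Aout : Set O}

/-- **Refining a certificate's tube** by a family of conditions `K p σ` with closed graph over
`[0, τc]`, satisfied at the start, and CERTIFIED along admissible curves (for every `p ∈ Ain` and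
every curve with the binders of `cert`, the endpoint lies in `K p σT`): the tube `Tube p σ ∩ K p σ`
is again a certificate, same regions. [folklore] -/
def restrict (C : ReachCertificate F U ε τc Ain Aout) (K : O → ℝ → Set O)
    (hK_closed : ∀ p ∈ Ain, IsClosed {z : ℝ × O | z.1 ∈ Icc 0 τc ∧ z.2 ∈ K p z.1})
    (hK_zero : ∀ p ∈ Ain, p ∈ K p 0)
    (hK_cert : ∀ p ∈ Ain, ∀ (σT : ℝ) (x : ℝ → O), 0 ≤ σT → σT ≤ τc → x 0 = p →
      ContinuousOn x (Icc 0 σT) → (∀ σ ∈ Ico 0 σT, x σ ∈ U) →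
        (∀ σ ∈ Ico 0 σT, ∃ W : O, HasDerivWithinAt x W (Ici σ) σ ∧ ‖W - F (x σ)‖ ≤ ε) →
          x σT ∈ K p σT) :
    ReachCertificate F U ε τc Ain Aout where
  Tube p σ := C.Tube p σ ∩ K p σ
  Tube_closed p hp := by
    have hEq : {z : ℝ × O | z.1 ∈ Icc 0 τc ∧ z.2 ∈ C.Tube p z.1 ∩ K p z.1} =
        {z : ℝ × O | z.1 ∈ Icc 0 τc ∧ z.2 ∈ C.Tube p z.1} ∩
          {z : ℝ × O | z.1 ∈ Icc 0 τc ∧ z.2 ∈ K p z.1} := by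
      ext z
      simp only [Set.mem_inter_iff, Set.mem_setOf_eq]
      tauto
    rw [hEq]
    exact (C.Tube_closed p hp).inter (hK_closed p hp)
  Tube_zero p hp := ⟨C.Tube_zero p hp, hK_zero p hp⟩
  Tube_sub p hp σ hσ := Set.inter_subset_left.trans (C.Tube_sub p hp σ hσ)
  cert p hp σT x h0 hσT hx0 hcont hU hW := by
    obtain ⟨hmem, hreach⟩ := C.cert p hp σT x h0 hσT hx0 hcont hU hW
    exact ⟨⟨hmem, hK_cert p hp σT x h0 hσT hx0 hcont hU hW⟩, hreach⟩

/-- The refined tube (definitional unfolding). [folklore] -/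
theorem restrict_tube (C : ReachCertificate F U ε τc Ain Aout) (K : O → ℝ → Set O)
    (hK_closed : ∀ p ∈ Ain, IsClosed {z : ℝ × O | z.1 ∈ Icc 0 τc ∧ z.2 ∈ K p z.1})
    (hK_zero : ∀ p ∈ Ain, p ∈ K p 0)
    (hK_cert : ∀ p ∈ Ain, ∀ (σT : ℝ) (x : ℝ → O), 0 ≤ σT → σT ≤ τc → x 0 = p →
      ContinuousOn x (Icc 0 σT) → (∀ σ ∈ Ico 0 σT, x σ ∈ U) →
        (∀ σ ∈ Ico 0 σT, ∃ W : O, HasDerivWithinAt x W (Ici σ) σ ∧ ‖W - F (x σ)‖ ≤ ε) →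
          x σT ∈ K p σT) (p : O) (σ : ℝ) :
    (C.restrict K hK_closed hK_zero hK_cert).Tube p σ = C.Tube p σ ∩ K p σ := rfl

/-- **A time-independent refinement**: a CLOSED set `S` containing the input readouts and certified
along admissible curves refines the tube to `Tube p σ ∩ S`. [folklore] -/
def restrictConst (C : ReachCertificate F U ε τc Ain Aout) (S : Set O) (hS : IsClosed S)
    (hS_zero : Ain ⊆ S)
    (hS_cert : ∀ p ∈ Ain, ∀ (σT : ℝ) (x : ℝ → O), 0 ≤ σT → σT ≤ τc → x 0 = p →
      ContinuousOn x (Icc 0 σT) → (∀ σ ∈ Ico 0 σT, x σ ∈ U) →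
        (∀ σ ∈ Ico 0 σT, ∃ W : O, HasDerivWithinAt x W (Ici σ) σ ∧ ‖W - F (x σ)‖ ≤ ε) →
          x σT ∈ S) :
    ReachCertificate F U ε τc Ain Aout :=
  C.restrict (fun _ _ => S)
    (fun _ _ => (isClosed_Icc.preimage continuous_fst).inter (hS.preimage continuous_snd))
    (fun _ hp => hS_zero hp) hS_cert

/-- The constantly refined tube (definitional unfolding). [folklore] -/
theorem restrictConst_tube (C : ReachCertificate F U ε τc Ain Aout) (S : Set O) (hS : IsClosed S)
    (hS_zero : Ain ⊆ S)
    (hS_cert : ∀ p ∈ Ain, ∀ (σT : ℝ) (x : ℝ → O), 0 ≤ σT → σT ≤ τc → x 0 = p →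
      ContinuousOn x (Icc 0 σT) → (∀ σ ∈ Ico 0 σT, x σ ∈ U) →
        (∀ σ ∈ Ico 0 σT, ∃ W : O, HasDerivWithinAt x W (Ici σ) σ ∧ ‖W - F (x σ)‖ ≤ ε) →
          x σT ∈ S) (p : O) (σ : ℝ) :
    (C.restrictConst S hS hS_zero hS_cert).Tube p σ = C.Tube p σ ∩ S := rfl

/-- **Shrinking the input region.** [folklore] -/
def monoIn (C : ReachCertificate F U ε τc Ain Aout) {Ain' : Set O} (h : Ain' ⊆ Ain) :
    ReachCertificate F U ε τc Ain' Aout where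
  Tube := C.Tube
  Tube_closed p hp := C.Tube_closed p (h hp)
  Tube_zero p hp := C.Tube_zero p (h hp)
  Tube_sub p hp := C.Tube_sub p (h hp)
  cert p hp := C.cert p (h hp)

/-- Same tube after shrinking the input region. [folklore] -/
theorem monoIn_tube (C : ReachCertificate F U ε τc Ain Aout) {Ain' : Set O} (h : Ain' ⊆ Ain)
    (p : O) (σ : ℝ) : (C.monoIn h).Tube p σ = C.Tube p σ := rfl

/-- **Enlarging the output region.** [folklore] -/
def monoOut (C : ReachCertificate F U ε τc Ain Aout) {Aout' : Set O} (h : Aout ⊆ Aout') :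
    ReachCertificate F U ε τc Ain Aout' where
  Tube := C.Tube
  Tube_closed := C.Tube_closed
  Tube_zero := C.Tube_zero
  Tube_sub := C.Tube_sub
  cert p hp σT x h0 hσT hx0 hcont hU hW := by
    obtain ⟨hmem, hreach⟩ := C.cert p hp σT x h0 hσT hx0 hcont hU hW
    refine ⟨hmem, fun hEq => ?_⟩
    obtain ⟨σ, hσ, hA⟩ := hreach hEq
    exact ⟨σ, hσ, h hA⟩

/-- Same tube after enlarging the output region. [folklore] -/
theorem monoOut_tube (C : ReachCertificate F U ε τc Ain Aout) {Aout' : Set O} (h : Aout ⊆ Aout')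
    (p : O) (σ : ℝ) : (C.monoOut h).Tube p σ = C.Tube p σ := rfl

/-- **Retargeting to the hand-off.** Any set containing the end-of-stage tubes `Tube p τc`,
`p ∈ Ain`, is a valid output region: REACH is witnessed at the final time `σ = τc` by tube
membership (for `τc ≥ 0`). This is the form `ReachCertificate.comp` consumes (`Amid ⊇ Tube₁ p τ₁`).
[folklore] -/
def withHandoff (C : ReachCertificate F U ε τc Ain Aout) (hτ : 0 ≤ τc) (Aout' : Set O)
    (h : ∀ p ∈ Ain, C.Tube p τc ⊆ Aout') : ReachCertificate F U ε τc Ain Aout' where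
  Tube := C.Tube
  Tube_closed := C.Tube_closed
  Tube_zero := C.Tube_zero
  Tube_sub := C.Tube_sub
  cert p hp σT x h0 hσT hx0 hcont hU hW := by
    obtain ⟨hmem, -⟩ := C.cert p hp σT x h0 hσT hx0 hcont hU hW
    refine ⟨hmem, fun hEq => ?_⟩
    subst hEq
    exact ⟨σT, ⟨hτ, le_rfl⟩, h p hp hmem⟩

/-- Same tube after retargeting. [folklore] -/
theorem withHandoff_tube (C : ReachCertificate F U ε τc Ain Aout) (hτ : 0 ≤ τc) (Aout' : Set O)
    (h : ∀ p ∈ Ain, C.Tube p τc ⊆ Aout') (p : O) (σ : ℝ) :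
    (C.withHandoff hτ Aout' h).Tube p σ = C.Tube p σ := rfl

/-- The canonical hand-off region: the union of the end-of-stage tubes. [folklore] -/
def handoff (C : ReachCertificate F U ε τc Ain Aout) : Set O := {X | ∃ p ∈ Ain, X ∈ C.Tube p τc}

/-- Each end-of-stage tube lies in the canonical hand-off region. [folklore] -/
theorem tube_subset_handoff (C : ReachCertificate F U ε τc Ain Aout) {p : O} (hp : p ∈ Ain) :
    C.Tube p τc ⊆ C.handoff := fun _ hX => ⟨p, hp, hX⟩

/-- The canonical hand-off region lies in the working region (for `τc ≥ 0`). [folklore] -/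
theorem handoff_subset (C : ReachCertificate F U ε τc Ain Aout) (hτ : 0 ≤ τc) :
    C.handoff ⊆ U := by
  rintro X ⟨p, hp, hX⟩
  exact C.Tube_sub p hp τc ⟨hτ, le_rfl⟩ hX

/-- **Retargeting to the canonical hand-off region.** [folklore] -/
def toHandoff (C : ReachCertificate F U ε τc Ain Aout) (hτ : 0 ≤ τc) :
    ReachCertificate F U ε τc Ain C.handoff :=
  C.withHandoff hτ C.handoff fun _ hp => C.tube_subset_handoff hp

/-- Same tube after retargeting to the canonical hand-off. [folklore] -/
theorem toHandoff_tube (C : ReachCertificate F U ε τc Ain Aout) (hτ : 0 ≤ τc) (p : O) (σ : ℝ) :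
    (C.toHandoff hτ).Tube p σ = C.Tube p σ := rfl

end ReachCertificate

end Literature.Analysis.FluidPDE.FluidComputer

end
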